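import Literature.Computability.Complexity.MurrayWilliams2018SimulationProofs
import HarnessLib

/-!
# Murray–Williams 2018, Thm. 2.1 (Umans' generator): the table form gives the string form

Literature / circuit complexity — derandomization. Two conditional assemblies of Murray–Williams'
Lemma 4.1 are in the tree, each taking Umans' generator (MW Thm. 2.1 = Umans 2003, Thm. 6) as a
hypothesis in its own rendering:

* the STRING form `UmansGenerator` (`MurrayWilliams2018SimulationProofs.lean`): `F ∈ FP` read on
  `⟨⟨Y, 1ˢ⟩, seed⟩`, seeds of length `g (⌊log₂ |Y|⌋ + 1)`, `SIZE(s)`-pseudorandom whenever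
  `1 ≤ s` and `sᵍ ≤ CC(Y)` (`stringCC`: the circuit complexity of the function with truth table
  `Y 1 0⋯0` padded to the least power of two, MW §2);
* the TABLE form `h21` of `MurrayWilliams2018Lemma41Assembly.lean`: `F ∈ FP` read on
  `⟨tt f, ⟨1ᵘ, σ⟩⟩` (`tableGenerator`, `HardnessVsRandomness.lean`) for a function
  `f : {0,1}ᵐ → {0,1}`, seeds of length `g · m`, `SIZE(u)`-pseudorandom whenever `1 ≤ u` and
  `uᵍ ≤ circuitSizeOver B2 f`.

This file PROVES that the table form yields the string form (`umansGenerator_of_tableForm`,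
`nonempty_umansGenerator_of_tableForm`), so that ONE formalization of Umans' theorem — naturally
in the table form, the generator being built from the truth table — serves both assemblies: pad
the string to its table inside `FP` (`padTableFn`, `padTableFn_apply`: the ruler `1^{2^k}`,
`k = ⌊log₂ (2|Y| + 1)⌋ = ⌈log₂ (|Y| + 1)⌉`, by `logFn`, the numeral `0ᵏ1` and the bounded
conversion `binToUnaryFn`; then `takeD`), read `Y` as the function `ofTruthTable (padTable Y)` on
`⌊log₂ |Y|⌋ + 1` variables (for `|Y| ≥ 1`; the empty string has `CC ≤ 1`, so only `s = 1` is
asked, where fooling with error `1` is free), and note that the two generators are the same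
function of the seed. Consequently `MurrayWilliams2018_lemma_4_1_ae_of_thm31_of_tableForm`:
Lemma 4.1 (a.e. form) from `h31` (universal-referee Thm. 3.1) and the table form.

Theorems and two `FP` bricks (definitions with bodies); nothing is asserted; no named fact
(D-0026).

## References

* C. D. Murray, R. R. Williams, *Circuit lower bounds for nondeterministic quasi-polytime: an easy
  witness lemma for NP and NQP*, STOC 2018, Thm. 2.1 and §2 (circuit complexity of strings)
  [MurrayWilliams2018].
* C. Umans, *Pseudo-random generators for all hardnesses*, J. Comput. Syst. Sci. 67 (2003)
  419–440, Thm. 6 (cited through MW Thm. 2.1).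
-/

noncomputable section

namespace Literature.Computability.Complexity

open _root_.Computability Filter Polynomial Brick Plumb MetaComplexity

/-! ### The padded table inside `FP` -/

/-- `⌊log₂ (2n + 1)⌋ = ⌈log₂ (n + 1)⌉`: the exponent of the least power of two `≥ n + 1`, read off
a word of length `2n + 1` by `logFn`. [folklore] -/
theorem log_two_mul_add_one (n : ℕ) : Nat.log 2 (2 * n + 1) = Nat.clog 2 (n + 1) := by
  rcases Nat.eq_zero_or_pos n with rfl | hn
  · simp
  · set k := Nat.clog 2 (n + 1) with hk
    have h1 : n + 1 ≤ 2 ^ k := Nat.le_pow_clog one_lt_two _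
    have hkpos : 1 ≤ k := Nat.clog_pos one_lt_two (by omega)
    have h2 : 2 ^ (k - 1) < n + 1 := Nat.pow_pred_clog_lt_self one_lt_two (by omega)
    have h3 : 2 ^ k = 2 * 2 ^ (k - 1) := by
      rw [← pow_succ']; congr 1; omega
    refine Nat.log_eq_of_pow_le_of_lt_pow ?_ ?_
    · omega
    · rw [pow_succ]; omega

/-- The ruler exponent word: `Y ↦ 1ᵏ`, `k = ⌊log₂ (2|Y| + 1)⌋`. [folklore] -/
def expRulerFn : List Bool → List Bool := logFn ∘ polyFn (2 * X + 1)

/-- **The padded table as an `FP` brick**: `Y ↦ Y 1 0^{2^k - |Y| - 1}`, `2^k` the least power of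
two `≥ |Y| + 1` — the numeral `0ᵏ1 = ⌞2ᵏ⌟`, converted to the ruler `1^{2^k}` under the cap
`2|Y| + 2 ≥ 2^k` (`binToUnaryFn`), then `takeD (2^k) (Y 1)`. [cite: MurrayWilliams2018, §2] -/
def padTableFn : List Bool → List Bool :=
  fstF ∘ padTakeFn ∘ fanoutFn
    (binToUnaryFn ∘ fanoutFn (polyFn (2 * X + 2)) ((fun w => Kannan.zerosFn w ++ [true]) ∘ expRulerFn))
    (fun w => w ++ [true])

/-- `expRulerFn ∈ FP`. [folklore] -/
theorem expRulerFn_mem_FP : expRulerFn ∈ FP := comp_mem_FP logFn_mem_FP (polyFn_mem_FP _)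

/-- `padTableFn ∈ FP`. [folklore] -/
theorem padTableFn_mem_FP : padTableFn ∈ FP :=
  comp_mem_FP fstF_mem_FP (comp_mem_FP padTakeFn_mem_FP (fanoutFn_mem_FP
    (comp_mem_FP binToUnaryFn_mem_FP (fanoutFn_mem_FP (polyFn_mem_FP _)
      (comp_mem_FP (append_mem_FP Kannan.zerosFn_mem_FP (const_mem_FP [true])) expRulerFn_mem_FP)))
    (append_mem_FP (PolyTimeComputable.id _) (const_mem_FP [true]))))

/-- `takeD` beyond the length pads with the default. [folklore] -/
theorem takeD_eq_append_replicate {n : ℕ} {l : List Bool} (h : l.length ≤ n) :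
    List.takeD n l false = l ++ List.replicate (n - l.length) false := by
  induction l generalizing n with
  | nil => rw [List.takeD_nil]; simp
  | cons b l ih =>
    cases n with
    | zero => simp at h
    | succ n =>
      rw [List.takeD_succ, List.length_cons, Nat.add_sub_add_right, List.head?_cons, Option.getD_some,
        List.tail_cons, ih (by simpa using h), List.cons_append]

/-- **Value of `padTableFn`**: the padded table `padTable Y` of `MurrayWilliams2018StringComplexity.lean`.
[cite: MurrayWilliams2018, §2] -/
theorem padTableFn_apply (Y : List Bool) : padTableFn Y = padTable Y := by
  have hk : Nat.log 2 (2 * Y.length + 1) = Nat.clog 2 (Y.length + 1) := log_two_mul_add_one _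
  have hpow : Y.length + 1 ≤ 2 ^ Nat.clog 2 (Y.length + 1) := Nat.le_pow_clog one_lt_two _
  have hcap : 2 ^ Nat.clog 2 (Y.length + 1) ≤ 2 * Y.length + 2 := by
    rcases Nat.eq_zero_or_pos Y.length with h0 | hpos
    · rw [h0]; simp
    · have h2 : 2 ^ (Nat.clog 2 (Y.length + 1) - 1) < Y.length + 1 :=
        Nat.pow_pred_clog_lt_self one_lt_two (by omega)
      have hkpos : 1 ≤ Nat.clog 2 (Y.length + 1) := Nat.clog_pos one_lt_two (by omega)
      have h3 : 2 ^ Nat.clog 2 (Y.length + 1) = 2 * 2 ^ (Nat.clog 2 (Y.length + 1) - 1) := by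
        rw [← pow_succ']; congr 1; omega
      omega
  simp only [padTableFn, expRulerFn, Function.comp_apply, fanoutFn_apply, polyFn_apply, eval_add,
    eval_mul, eval_ofNat, eval_X, eval_one, logFn, ones, List.length_replicate, Kannan.zerosFn_apply,
    binToUnaryFn_boolPair, padTakeFn_boolPair, fstF_boolPair]
  rw [← Com.encodeNat_two_pow, bitsToNat_encodeNat, hk, min_eq_left hcap,
    takeD_eq_append_replicate (by simpa using hpow), padTable]
  simp

/-! ### The circuit complexity of a table does not depend on how its length is written -/

/-- Reading the same table at two presentations `2ᵃ = |T| = 2ᵇ` of its length gives functions of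
the same circuit complexity (`a = b`, proof irrelevance). [folklore] -/
theorem circuitSizeOver_ofTruthTable_congr {T : List Bool} {a b : ℕ} (h₁ : T.length = 2 ^ a)
    (h₂ : T.length = 2 ^ b) :
    circuitSizeOver B2 (ofTruthTable T h₁) = circuitSizeOver B2 (ofTruthTable T h₂) := by
  have hab : a = b := Nat.pow_right_injective le_rfl (h₁.symm.trans h₂)
  subst hab
  rfl

/-! ### The string form from the table form -/

/-- **The generator in string form**, from a table-form generator `F`: `⟨⟨Y, 1ˢ⟩, seed⟩ ↦
F ⟨padTable Y, ⟨1ˢ, seed⟩⟩`. [cite: MurrayWilliams2018, Thm. 2.1] -/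
def stringGenFn (F : List Bool → List Bool) : List Bool → List Bool :=
  F ∘ fanoutFn (padTableFn ∘ fstF ∘ fstF) (fanoutFn (sndF ∘ fstF) sndF)

/-- `stringGenFn F ∈ FP` for `F ∈ FP`. [folklore] -/
theorem stringGenFn_mem_FP {F : List Bool → List Bool} (hF : F ∈ FP) : stringGenFn F ∈ FP :=
  comp_mem_FP hF (fanoutFn_mem_FP (comp_mem_FP padTableFn_mem_FP (comp_mem_FP fstF_mem_FP fstF_mem_FP))
    (fanoutFn_mem_FP (comp_mem_FP sndF_mem_FP fstF_mem_FP) sndF_mem_FP))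

/-- Value of `stringGenFn`. [folklore] -/
theorem stringGenFn_apply (F : List Bool → List Bool) (Y u seed : List Bool) :
    stringGenFn F (boolPair (boolPair Y u) seed) = F (boolPair (padTable Y) (boolPair u seed)) := by
  simp [stringGenFn, fstF, sndF, padTableFn_apply]

/-- **Umans' generator in the table form gives it in the string form** (Murray–Williams 2018,
Thm. 2.1, two renderings): from `g ≥ 1` and `F ∈ FP` with the table-form pseudorandomness
(hypothesis `h21` of `MurrayWilliams2018Lemma41Assembly.lean`), the string-form data
`UmansGenerator` with `F' = stringGenFn F` and the same `g`. For `|Y| ≥ 1` the string `Y` is the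
function `ofTruthTable (padTable Y)` on `m = ⌊log₂ |Y|⌋ + 1 = ⌈log₂ (|Y|+1)⌉` variables, of
circuit complexity `CC(Y)` (`stringCC`), and the two generators agree seed by seed; for `Y = ε`,
`CC(ε) ≤ 1` forces `s = 1`, where fooling with error `1/s = 1` is free (`fools_of_one_le`).
[cite: MurrayWilliams2018, Thm. 2.1] -/
def umansGenerator_of_tableForm {g : ℕ} (hg : 1 ≤ g) {F : List Bool → List Bool} (hF : F ∈ FP)
    (h21 : ∀ (m u : ℕ) (f : (Fin m → Bool) → Bool), 1 ≤ u → u ^ g ≤ circuitSizeOver B2 f →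
      IsSizePseudorandom (tableGenerator F f (g * m) u)) : UmansGenerator where
  F := stringGenFn F
  g := g
  F_mem_FP := stringGenFn_mem_FP hF
  one_le_g := hg
  fools := by
    intro Y s h1 hhard
    rcases Nat.eq_zero_or_pos Y.length with h0 | hpos
    · -- `Y = ε`: `CC(ε) ≤ 1`, so `s = 1`, and error `1` is free
      have hY : Y = [] := List.eq_nil_of_length_eq_zero h0
      have hcc : stringCC Y ≤ 1 := by
        subst hY
        unfold stringCC
        -- a `0`-variable table `[1]`: the constant circuit has one gate
        have hB : (Circuit.const (Fin (Nat.clog 2 (([] : List Bool).length + 1)))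
            (ofTruthTable (padTable []) (length_padTable []) fun _ => false)).IsOver B2 := by
          intro g' hg'
          simp only [Circuit.const, List.mem_singleton] at hg'
          subst hg'
          change (0 : ℕ) ≤ 2
          omega
        have hc : (Circuit.const (Fin (Nat.clog 2 (([] : List Bool).length + 1)))
            (ofTruthTable (padTable []) (length_padTable []) fun _ => false)).Computes
            (ofTruthTable (padTable []) (length_padTable [])) := by
          intro x
          rw [Circuit.eval_const]
          have : x = fun _ => false := funext fun i => by
            exfalso
            have hi := i.isLt
            simp at hi
          rw [this]
        exact (circuitSizeOver_le_of_computes _ hB hc).trans (by simp)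
      have hs : s = 1 := by
        have h2 : s ^ g ≤ 1 := hhard.trans hcc
        have h3 : s ≤ s ^ g := Nat.le_self_pow (by omega) s
        omega
      subst hs
      exact fools_of_one_le _ _ (by norm_num)
    · -- `|Y| ≥ 1`: read `Y` as a function on `⌊log₂ |Y|⌋ + 1` variables
      have hm : Nat.clog 2 (Y.length + 1) = Nat.log 2 Y.length + 1 := by
        rw [← log_two_mul_add_one]
        -- `⌊log₂ (2n+1)⌋ = ⌊log₂ n⌋ + 1` for `n ≥ 1`
        have h1' : Nat.log 2 (2 * Y.length + 1) = Nat.log 2 ((2 * Y.length + 1) / 2) + 1 :=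
          Nat.log_of_one_lt_of_le one_lt_two (by omega)
        rw [h1']
        congr 2
        omega
      have hlen : (padTable Y).length = 2 ^ (Nat.log 2 Y.length + 1) := by
        rw [length_padTable, hm]
      set f : (Fin (Nat.log 2 Y.length + 1) → Bool) → Bool := ofTruthTable (padTable Y) hlen with hf
      have hcc : stringCC Y = circuitSizeOver B2 f := by
        rw [hf, stringCC]
        exact circuitSizeOver_ofTruthTable_congr _ _
      have hps := h21 (Nat.log 2 Y.length + 1) s f h1 (by rw [← hcc]; exact hhard)
      have hgen : (fun (seed : Fin (g * (Nat.log 2 Y.length + 1)) → Bool) (i : Fin s) =>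
          (stringGenFn F (boolPair (boolPair Y (ones s)) (List.ofFn seed))).getD i false) =
          tableGenerator F f (g * (Nat.log 2 Y.length + 1)) s := by
        funext seed i
        rw [tableGenerator_apply, stringGenFn_apply, hf, truthTable_ofTruthTable,
          OracleCompose.unaryEncodeNat_eq_replicate]
      rw [hgen]
      exact hps

/-- **The table form gives the string form** (existence). [cite: MurrayWilliams2018, Thm. 2.1] -/
theorem nonempty_umansGenerator_of_tableForm
    (h21 : ∃ g : ℕ, 1 ≤ g ∧ ∃ F : List Bool → List Bool, F ∈ FP ∧
      ∀ (m u : ℕ) (f : (Fin m → Bool) → Bool), 1 ≤ u → u ^ g ≤ circuitSizeOver B2 f →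
        IsSizePseudorandom (tableGenerator F f (g * m) u)) :
    Nonempty UmansGenerator := by
  obtain ⟨g, hg, F, hF, h⟩ := h21
  exact ⟨umansGenerator_of_tableForm hg hF h⟩

/-- **Lemma 4.1 (a.e. form) from `h31` and Umans' generator in the table form.**
[cite: MurrayWilliams2018, Lemma 4.1] -/
theorem MurrayWilliams2018_lemma_4_1_ae_of_thm31_of_tableForm
    (h31 : ∃ Ref : Language Bool, Ref ∈ Classes.P ∧ ∃ D : ℕ, 1 ≤ D ∧
      ∀ (s : ℕ → ℕ) (D' : ℕ), D * D + D + 2 ≤ D' → StrictMono s → IsTimeConstructible s →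
        (∀ᶠ n in atTop, n * s n ^ 2 < 2 ^ n) →
        ∃ (adv : ℕ → List Bool) (L₁ : Language Bool),
          (∀ n, (adv n).length ≤ D * (Nat.log 2 (s n ^ D') + 1)) ∧
          AdvisedMAGame Ref (mwMoveLen s D D') adv L₁ ∧
          ∀ᶠ n in atTop, s n < L₁.circuitSize n ∨ s (s n ^ D') < L₁.circuitSize (s n ^ D'))
    (h21 : ∃ g : ℕ, 1 ≤ g ∧ ∃ F : List Bool → List Bool, F ∈ FP ∧
      ∀ (m u : ℕ) (f : (Fin m → Bool) → Bool), 1 ≤ u → u ^ g ≤ circuitSizeOver B2 f →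
        IsSizePseudorandom (tableGenerator F f (g * m) u)) :
    MurrayWilliams2018_lemma_4_1_ae := by
  obtain ⟨G⟩ := nonempty_umansGenerator_of_tableForm h21
  exact MurrayWilliams2018_lemma_4_1_ae_of_thm31_of_umansGenerator h31 G

end Literature.Computability.Complexity

end
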